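import Literature.NumberTheory.EllipticCurves.Sprung2017.SharpFlatPAdicLFunction
import Literature.NumberTheory.EllipticCurves.PlusMinusPAdicLFunctionProofs
import HarnessLib

/-!
# TRIAGE r1 seat 1 (gen 4) — the level-1 `♯`-certificate behind the `sharpen:` line on
`chromatic-common-zeros` (stub S0) in `TRIAGE-r1-1.md`, Gen-4 addendum, Finding B

crux stmt-BirchSwinnertonDyer-19875 `SprungLowerDivisibilityAtThree`; seat refuter-cruxtriage-…-r1-1 (g4, 2026-08-28).
Evidence only: NO idea verdict depends on this file; BSD / K1 / the X8 leaf / stub S0 are NOT proved here.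

Content. In a Sprung pair `θ_n ≡ −(u_n L♯ + v_n L♭) (mod ω_n)` (`IsSprungPair`), the ONLY exact
vanishings among the recursion polynomials are `u_0 = 0` and `v_1 = 0` (`sharpPoly_zero`,
`flatPoly_one`); hence level `1` isolates the `♯` colour EXACTLY (no reduction mod `p`, no parity of a
winding level): `θ_1 ≡ −L♯ (mod ω_1)`, and evaluating at `χ(γ) − 1` for an even `p`-power-order
character `χ` modulo `p^{1+e₀}` (`= 9` at `p = 3`) gives Birch's sum. So ONE non-vanishing Birch sum
`∑_{a mod p^{1+e₀}} χ(a)[a/p^{1+e₀}]⁺_f ≠ 0` (equivalently `L(E, χ̄, 1) ≠ 0` for ONE even character of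
conductor dividing `9` and `3`-power order, by `ratTwistedSymbolSum_mul_plusPeriod`) certifies `L♯ ≠ 0`
for EVERY Sprung pair of `f` at `p`, whatever `a_p` (theorem
`sharp_ne_zero_of_ratTwistedSymbolSum_ne_zero`). Level `0` gives the `♭` analogue with the trivial
character, i.e. the constant-term table (useless at `r_an ≥ 1`; recorded as
`flat_ne_zero_of_ratTwistedSymbolSum_ne_zero`). For `n ≥ 2` and `a_p ≠ 0` neither `u_n` nor `v_n`
vanishes at primitive level-`n` characters (`u_2 = a_p`, `v_2(ζ−1) = −Φ_p(ζ)`), which is why Rohrlich's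
theorem alone yields only `L♯ ≠ 0 ∨ L♭ ≠ 0` (tree: `IsSprungPair.ne_zero_or_ne_zero`) and NOT stub S0.

`lean check`: rc 0 expected, 0 sorries; axioms {propext, Classical.choice, Quot.sound}.
The first lemma re-proves the private `ratTwistedSymbolSum_eq_zero_of_isCongrModOmega_zero` of
`Sprung2017/SharpFlatNonvanishingProofs.lean` (private there, so not importable).
-/

set_option autoImplicit false
set_option linter.dupNamespace false

noncomputable section

open scoped MatrixGroups ModularForm

open CongruenceSubgroup Polynomial Literature.NumberTheory.EllipticCurves
  Literature.NumberTheory.EllipticCurves.ModularForms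
  Literature.NumberTheory.EllipticCurves.Sprung2017

namespace Summit.BirchSwinnertonDyer.BirchSwinnertonDyer.Cruxes.SprungLowerDivisibilityAtThree.TriageR11

variable {N : ℕ} {f : CuspForm (Gamma0 N) 2} {p : ℕ} [Fact p.Prime]

/-- If `θ_n ≡ ω · 0 (mod ω_n)` in `Λ ⊗ ℚ_p`, every Birch sum at an even `p`-power-order character
modulo `p^{n+e₀}` vanishes (evaluate at `χ(γ) − 1`: `IsCongrModOmega.eval₂_eq`,
`eval₂_mazurTateElement_eq_ratTwistedSymbolSum`). Copy of the private lemma of the same name in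
`Sprung2017/SharpFlatNonvanishingProofs.lean`. [cite: Pollack2003, Prop. 6.9 (proof)] -/
theorem ratTwistedSymbolSum_eq_zero_of_isCongrModOmega_zero {n : ℕ} {ω : ℤ[X]}
    (h : IsCongrModOmega p n (mazurTateElement f p n) ω 0)
    (χ : DirichletCharacter ℂ_[p] (p ^ (n + cyclotomicExponent p))) (hev : χ.Even)
    (hord : ∃ j : ℕ, orderOf χ = p ^ j) : ratTwistedSymbolSum f χ = 0 := by
  set ζ : ℂ_[p] := χ (cyclotomicGenerator p : ZMod (p ^ (n + cyclotomicExponent p))) with hζ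
  have hpow : ζ ^ p ^ n = 1 := by
    rw [hζ, ← map_pow, ← orderOf_cyclotomicGenerator p n, pow_orderOf_eq_one, map_one]
  have hz : ‖ζ - 1‖ < 1 := norm_sub_one_lt_one_of_pow_prime_pow_eq_one hpow
  have hzn : (1 + (ζ - 1)) ^ p ^ n = 1 := by rwa [add_sub_cancel]
  have h1 := h.eval₂_eq hz hzn
  rw [eval₂_mazurTateElement_eq_ratTwistedSymbolSum f χ hev hord] at h1
  rw [h1]
  simp

/-- **Level-1 exact `♯`-certificate.** For ANY Sprung pair `(L♯, L♭)` of `f` at `p` (any `ap`):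
since `u_1 = 1`, `v_1 = 0`, the level-1 clause reads `θ_1 ≡ −L♯ (mod ω_1)`; so if some even
`p`-power-order Dirichlet character `χ` modulo `p^{1+e₀}` (conductor `1` or `9` at `p = 3`) has
`∑_a χ(a)[a/p^{1+e₀}]⁺_f ≠ 0`, then `L♯ ≠ 0`. This is the per-pair certificate for the `♯` half of
stub S0 of line `chromatic-common-zeros` that does NOT go through a reduction mod `p` / winding parity.
[cite: Sprung2017, Cor. 4.4 (u_1 = 1, v_1 = 0)] [cite: Pollack2003, Prop. 6.9 (proof)] -/
theorem sharp_ne_zero_of_ratTwistedSymbolSum_ne_zero {ap : ℤ} {Lsharp Lflat : IwasawaAlgebra p}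
    (hSP : IsSprungPair f p ap Lsharp Lflat)
    (χ : DirichletCharacter ℂ_[p] (p ^ (1 + cyclotomicExponent p))) (hev : χ.Even)
    (hord : ∃ j : ℕ, orderOf χ = p ^ j) (hχ : ratTwistedSymbolSum f χ ≠ 0) : Lsharp ≠ 0 := by
  intro h0
  apply hχ
  have h1 := hSP 1
  rw [sharpPoly_one, flatPoly_one, map_one, map_zero, one_mul, zero_mul, add_zero, h0] at h1
  exact ratTwistedSymbolSum_eq_zero_of_isCongrModOmega_zero h1 χ hev hord

/-- **Level-0 exact `♭`-certificate** (the constant-term table in certificate form): since `u_0 = 0`,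
`v_0 = 1`, the level-0 clause reads `θ_0 ≡ −L♭ (mod T)`; so a non-vanishing Birch sum at an even
`p`-power-order character modulo `p^{e₀}` (necessarily trivial for odd `p`, i.e. `(a_p − 2)·[0]⁺_f ≠ 0`,
i.e. `L(E,1) ≠ 0` when `a_p ≠ 2`) gives `L♭ ≠ 0`. Useless at `r_an ≥ 1` — recorded to make the point
that NO level isolates `♭` exactly away from the constant term when `a_p ≠ 0`.
[cite: Sprung2017, Cor. 4.4 (u_0 = 0, v_0 = 1)] [cite: Pollack2003, Prop. 6.9 (proof)] -/
theorem flat_ne_zero_of_ratTwistedSymbolSum_ne_zero {ap : ℤ} {Lsharp Lflat : IwasawaAlgebra p}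
    (hSP : IsSprungPair f p ap Lsharp Lflat)
    (χ : DirichletCharacter ℂ_[p] (p ^ (0 + cyclotomicExponent p))) (hev : χ.Even)
    (hord : ∃ j : ℕ, orderOf χ = p ^ j) (hχ : ratTwistedSymbolSum f χ ≠ 0) : Lflat ≠ 0 := by
  intro h0
  apply hχ
  have h1 := hSP 0
  rw [sharpPoly_zero, flatPoly_zero, map_one, map_zero, one_mul, zero_mul, zero_add, h0] at h1
  exact ratTwistedSymbolSum_eq_zero_of_isCongrModOmega_zero h1 χ hev hord

/-- `u_2 = a_p` is a NON-ZERO constant when `a_p ≠ 0` (so at level `2` the `♯` term never drops out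
exactly; with `v_2 = −Φ_p(1+T)`, non-zero at primitive level-2 characters, Rohrlich at level `≥ 2`
cannot isolate a colour). [cite: Sprung2017, Cor. 4.4 (u_2 = a_p)] -/
theorem sharpPoly_two_ne_zero {ap : ℤ} (hap : ap ≠ 0) (p : ℕ) : sharpPoly ap p 2 ≠ 0 := by
  rw [sharpPoly_two]
  exact Polynomial.C_ne_zero.mpr hap

/-- `v_2 = −Φ_p(1+T) ≠ 0` in `ℤ[T]`. [cite: Sprung2017, Cor. 4.4 (v_2)] -/
theorem flatPoly_two_ne_zero (ap : ℤ) {p : ℕ} (hp : 0 < p) : flatPoly ap p 2 ≠ 0 := by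
  rw [flatPoly_two, neg_ne_zero]
  intro h
  have hX : (X + 1 : ℤ[X]).natDegree = 1 := by
    rw [← Polynomial.C_1, Polynomial.natDegree_X_add_C]
  have hdeg := congrArg Polynomial.natDegree h
  rw [Polynomial.natDegree_comp, Polynomial.natDegree_cyclotomic, pow_one, hX, mul_one,
    Polynomial.natDegree_zero] at hdeg
  exact absurd hdeg (Nat.totient_pos.mpr hp).ne'

end Summit.BirchSwinnertonDyer.BirchSwinnertonDyer.Cruxes.SprungLowerDivisibilityAtThree.TriageR11

end
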